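import Summits.ValiantsHypothesis.ValiantsHypothesis.Theses.RigidMinimalReps
import Literature.Computability.AlgebraicComplexity.DetReprEquivalent
import Literature.Computability.AlgebraicComplexity.LRLiftCharacter
import Literature.Computability.AlgebraicComplexity.LRFullLifts
import Literature.Computability.AlgebraicComplexity.DeterminantalComplexityProofs

/-!
# `OrbitsForceTorus`, part 1 — the normalised two-sided torus action on determinantal
representations of `per_n`

Route `route-ValiantsHypothesis-RigidMinimalReps`, helper file for item `stmt-ValiantsHypothesis-5115`
(`OrbitsForceTorus : DoublyMinimalFinite → MinimalRepTorusSymmetric`; the orbit argument and the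
closing theorem are in `RigidMinimalRepsOrbitsForceTorus.lean`).

On `s × s` matrices of affine forms in the `n²` variables `x_{kl}` the torus `T = (ℂˣ)ⁿ × (ℂˣ)ⁿ`
acts by `(d, e) ⋆ A = D_{d,e} · A(x_{kl} ↦ d_k e_l x_{kl})` with
`D_{d,e} = diag(χ(d,e)⁻¹ at i₀, 1 elsewhere)`, `χ(d,e) = ∏ d · ∏ e` (`torusAct`).  Since
`per_n(d_k e_l x_{kl}) = χ(d,e) · per_n` (`LRPencil.linSubst_diagonal_perPoly`), `⋆` preserves affine
determinantal representations of `per_n` (`isAffineDetRepr_torusAct`) and does not raise the total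
coefficient rank `Σ_v rank A_v` (`rankSum_torusAct_le`); it is a genuine action
(`torusAct_mul`, `torusAct_one`) commuting with the gauge action `A ↦ P A Q` up to conjugating `P`
(`torusAct_gauge`).  Also: exact lifts `A(γ·x) = P A Q` are closed under `1, *, ⁻¹` in `γ`
(`lifts_one/mul/inv`), roots exist in `T` (`exists_pow_eq`), and a representation of `per_n`,
`n ≥ 1`, has positive size (`pos_of_isAffineDetRepr`).
-/

-- `Summit.<Summit>.<Problem>` repeats `ValiantsHypothesis` by the tree's layout convention (D-0017).
set_option linter.dupNamespace false

noncomputable section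

namespace Summit.ValiantsHypothesis.ValiantsHypothesis.Theorems.RigidMinimalRepsOrbitsForceTorus

open Literature.Computability.AlgebraicComplexity
open Literature.Computability.AlgebraicComplexity.LRPencil
open MvPolynomial Matrix
open scoped Kronecker

/-! ### Exact lifts are closed under the group operations -/

section Lifts

variable {k : Type*} [CommRing k] {σ : Type*} [Fintype σ] [DecidableEq σ]
  {ι : Type*} [Fintype ι] [DecidableEq ι]

/-- The identity substitution lifts: `A(1·x) = 1 · A · 1`. -/
theorem lifts_one (A : Matrix ι ι (MvPolynomial σ k)) :
    ∃ P Q : GL ι k, Matrix.linSubstEntries 1 A = (P : Matrix ι ι k).map C * A * (Q : Matrix ι ι k).map C :=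
  ⟨1, 1, by simp [Matrix.map_one C C_0 C_1]⟩

/-- Exact lifts compose: if `A(a·x) = P_a A Q_a` and `A(b·x) = P_b A Q_b` then
`A((ab)·x) = P_b P_a · A · Q_a Q_b`. -/
theorem lifts_mul {A : Matrix ι ι (MvPolynomial σ k)} {a b : GL σ k}
    (ha : ∃ P Q : GL ι k, Matrix.linSubstEntries a A = (P : Matrix ι ι k).map C * A * (Q : Matrix ι ι k).map C)
    (hb : ∃ P Q : GL ι k, Matrix.linSubstEntries b A = (P : Matrix ι ι k).map C * A * (Q : Matrix ι ι k).map C) :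
    ∃ P Q : GL ι k, Matrix.linSubstEntries (a * b) A = (P : Matrix ι ι k).map C * A * (Q : Matrix ι ι k).map C := by
  obtain ⟨Pa, Qa, ha⟩ := ha
  obtain ⟨Pb, Qb, hb⟩ := hb
  refine ⟨Pb * Pa, Qa * Qb, ?_⟩
  rw [← Matrix.linSubstEntries_linSubstEntries, hb, Matrix.linSubstEntries_mul,
    Matrix.linSubstEntries_mul, Matrix.linSubstEntries_map_C, Matrix.linSubstEntries_map_C, ha]
  simp only [Units.val_mul, Matrix.map_mul, Matrix.mul_assoc]

/-- Exact lifts invert: if `A(a·x) = P A Q` then `A(a⁻¹·x) = P⁻¹ A Q⁻¹`. -/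
theorem lifts_inv {A : Matrix ι ι (MvPolynomial σ k)} {a : GL σ k}
    (ha : ∃ P Q : GL ι k, Matrix.linSubstEntries a A = (P : Matrix ι ι k).map C * A * (Q : Matrix ι ι k).map C) :
    ∃ P Q : GL ι k, Matrix.linSubstEntries a⁻¹ A = (P : Matrix ι ι k).map C * A * (Q : Matrix ι ι k).map C := by
  obtain ⟨P, Q, e⟩ := ha
  refine ⟨P⁻¹, Q⁻¹, ?_⟩
  have h1 : (P : Matrix ι ι k).map C * Matrix.linSubstEntries a⁻¹ A * (Q : Matrix ι ι k).map C = A := by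
    rw [← Matrix.linSubstEntries_map_C a⁻¹ (P : Matrix ι ι k),
      ← Matrix.linSubstEntries_map_C a⁻¹ (Q : Matrix ι ι k), ← Matrix.linSubstEntries_mul,
      ← Matrix.linSubstEntries_mul, ← e, Matrix.linSubstEntries_inv_linSubstEntries]
  calc Matrix.linSubstEntries a⁻¹ A
      = ((P⁻¹ : GL ι k) : Matrix ι ι k).map C *
          ((P : Matrix ι ι k).map C * Matrix.linSubstEntries a⁻¹ A * (Q : Matrix ι ι k).map C) *
        ((Q⁻¹ : GL ι k) : Matrix ι ι k).map C := (inv_map_C_mul_mul_map_C_inv P Q _).symm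
    _ = _ := by rw [h1]

end Lifts

/-! ### The two-sided torus and its normalised action on representations -/

variable {n s : ℕ}

/-- The character `χ(d, e) = ∏ d · ∏ e` by which `x_{kl} ↦ d_k e_l x_{kl}` rescales `per_n`. -/
def torusChar (d e : Fin n → ℂˣ) : ℂˣ := (∏ i, d i) * ∏ j, e j

/-- `χ` is multiplicative. -/
theorem torusChar_mul (d d' e e' : Fin n → ℂˣ) :
    torusChar (d * d') (e * e') = torusChar d e * torusChar d' e' := by
  simp only [torusChar, Pi.mul_apply, Finset.prod_mul_distrib]
  exact mul_mul_mul_comm _ _ _ _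

/-- `χ(1, 1) = 1`. -/
theorem torusChar_one : torusChar (1 : Fin n → ℂˣ) 1 = 1 := by
  simp [torusChar]

/-- `χ` as a product of complex numbers. -/
theorem coe_torusChar (d e : Fin n → ℂˣ) :
    (torusChar d e : ℂ) = (∏ i, (d i : ℂ)) * ∏ j, (e j : ℂ) := by
  simp [torusChar]

/-- The diagonal of the normalising matrix `D_{d,e} = diag(…, χ⁻¹ at i₀, …, 1 elsewhere)`. -/
def normVec (i₀ : Fin s) (d e : Fin n → ℂˣ) : Fin s → ℂ :=
  fun i => if i = i₀ then (((torusChar d e)⁻¹ : ℂˣ) : ℂ) else 1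

/-- The normalising diagonal has nonzero entries. -/
theorem normVec_ne_zero (i₀ : Fin s) (d e : Fin n → ℂˣ) (i : Fin s) : normVec i₀ d e i ≠ 0 := by
  unfold normVec
  split_ifs
  · exact Units.ne_zero _
  · exact one_ne_zero

/-- `normVec` is multiplicative. -/
theorem normVec_mul (i₀ : Fin s) (d d' e e' : Fin n → ℂˣ) :
    normVec i₀ (d * d') (e * e') = normVec i₀ d e * normVec i₀ d' e' := by
  funext i
  simp only [normVec, Pi.mul_apply, torusChar_mul, mul_inv]
  split_ifs
  · exact Units.val_mul _ _
  · exact (mul_one _).symm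

/-- `normVec` at the identity. -/
theorem normVec_one (i₀ : Fin s) : normVec i₀ (1 : Fin n → ℂˣ) 1 = fun _ => 1 := by
  funext i
  simp [normVec, torusChar_one]

/-- The normalising matrix `D_{d,e}` as an element of `GL_s(ℂ)`. -/
def normGL (i₀ : Fin s) (d e : Fin n → ℂˣ) : GL (Fin s) ℂ :=
  diagUnit ℂ (normVec i₀ d e) (normVec_ne_zero i₀ d e)

/-- The matrix of `normGL`. -/
theorem coe_normGL (i₀ : Fin s) (d e : Fin n → ℂˣ) :
    ((normGL i₀ d e : GL (Fin s) ℂ) : Matrix (Fin s) (Fin s) ℂ) = diagonal (normVec i₀ d e) := rfl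

/-- `D` is multiplicative. -/
theorem normGL_mul (i₀ : Fin s) (d d' e e' : Fin n → ℂˣ) :
    normGL i₀ (d * d') (e * e') = normGL i₀ d e * normGL i₀ d' e' := by
  apply Units.ext
  rw [Units.val_mul, coe_normGL, coe_normGL, coe_normGL, diagonal_mul_diagonal, normVec_mul]
  rfl

/-- `D_{1,1} = 1`. -/
theorem normGL_one (i₀ : Fin s) : normGL i₀ (1 : Fin n → ℂˣ) 1 = 1 := by
  apply Units.ext
  rw [coe_normGL, normVec_one, Units.val_one]
  exact diagonal_one

/-- `det D_{d,e} = χ(d,e)⁻¹`. -/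
theorem det_normGL (i₀ : Fin s) (d e : Fin n → ℂˣ) :
    ((normGL i₀ d e : GL (Fin s) ℂ) : Matrix (Fin s) (Fin s) ℂ).det = (((torusChar d e)⁻¹ : ℂˣ) : ℂ) := by
  rw [coe_normGL, det_diagonal]
  simp [normVec, Finset.prod_ite_eq']

/-- The torus element `diag(d) ⊗ diag(e)` of `GL(n²)`: the substitution `x_{kl} ↦ d_k e_l x_{kl}`. -/
def torusGL (d e : Fin n → ℂˣ) : GL (Fin n × Fin n) ℂ :=
  Matrix.GeneralLinearGroup.kronecker (diagUnit ℂ (fun i => (d i : ℂ)) fun i => (d i).ne_zero)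
    (diagUnit ℂ (fun j => (e j : ℂ)) fun j => (e j).ne_zero)

/-- The matrix of `torusGL` in Kronecker form. -/
theorem coe_torusGL (d e : Fin n → ℂˣ) :
    ((torusGL d e : GL (Fin n × Fin n) ℂ) : Matrix (Fin n × Fin n) (Fin n × Fin n) ℂ) =
      diagonal (fun i => (d i : ℂ)) ⊗ₖ diagonal (fun j => (e j : ℂ)) := rfl

/-- The matrix of `torusGL` as one diagonal matrix. -/
theorem coe_torusGL' (d e : Fin n → ℂˣ) :
    ((torusGL d e : GL (Fin n × Fin n) ℂ) : Matrix (Fin n × Fin n) (Fin n × Fin n) ℂ) =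
      diagonal (fun p : Fin n × Fin n => (d p.1 : ℂ) * e p.2) := by
  rw [coe_torusGL, diagonal_kronecker_diagonal]

/-- `torusGL` is multiplicative. -/
theorem torusGL_mul (d d' e e' : Fin n → ℂˣ) :
    torusGL (d * d') (e * e') = torusGL d e * torusGL d' e' := by
  apply Units.ext
  rw [Units.val_mul, coe_torusGL', coe_torusGL', coe_torusGL', diagonal_mul_diagonal]
  congr 1
  funext p
  simp only [Pi.mul_apply, Units.val_mul]
  ring

/-- `torusGL 1 1 = 1`. -/
theorem torusGL_one : torusGL (1 : Fin n → ℂˣ) 1 = 1 := by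
  apply Units.ext
  rw [coe_torusGL', Units.val_one]
  simp

/-- The normalised torus action on `s × s` matrices of polynomials:
`(d, e) ⋆ A = D_{d,e} · A(x_{kl} ↦ d_k e_l x_{kl})`. -/
def torusAct (i₀ : Fin s) (d e : Fin n → ℂˣ)
    (A : Matrix (Fin s) (Fin s) (MvPolynomial (Fin n × Fin n) ℂ)) :
    Matrix (Fin s) (Fin s) (MvPolynomial (Fin n × Fin n) ℂ) :=
  ((normGL i₀ d e : GL (Fin s) ℂ) : Matrix (Fin s) (Fin s) ℂ).map C *
    Matrix.linSubstEntries (torusGL d e) A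

variable (i₀ : Fin s)

/-- `⋆` is an action: `(d,e) ⋆ ((d',e') ⋆ A) = (dd', ee') ⋆ A`. -/
theorem torusAct_mul (d d' e e' : Fin n → ℂˣ)
    (A : Matrix (Fin s) (Fin s) (MvPolynomial (Fin n × Fin n) ℂ)) :
    torusAct i₀ d e (torusAct i₀ d' e' A) = torusAct i₀ (d * d') (e * e') A := by
  unfold torusAct
  rw [Matrix.linSubstEntries_mul, Matrix.linSubstEntries_map_C,
    Matrix.linSubstEntries_linSubstEntries, ← torusGL_mul, normGL_mul, Units.val_mul, Matrix.map_mul,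
    Matrix.mul_assoc]

/-- `(1,1) ⋆ A = A`. -/
theorem torusAct_one (A : Matrix (Fin s) (Fin s) (MvPolynomial (Fin n × Fin n) ℂ)) :
    torusAct i₀ (1 : Fin n → ℂˣ) 1 A = A := by
  unfold torusAct
  rw [torusGL_one, normGL_one, Matrix.linSubstEntries_one, Units.val_one, Matrix.map_one C C_0 C_1,
    Matrix.one_mul]

/-- `⋆` commutes with the gauge action up to conjugating the left factor by `D`. -/
theorem torusAct_gauge (d e : Fin n → ℂˣ) (P Q : GL (Fin s) ℂ)
    (A : Matrix (Fin s) (Fin s) (MvPolynomial (Fin n × Fin n) ℂ)) :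
    torusAct i₀ d e ((P : Matrix (Fin s) (Fin s) ℂ).map C * A * (Q : Matrix (Fin s) (Fin s) ℂ).map C) =
      ((normGL i₀ d e * P * (normGL i₀ d e)⁻¹ : GL (Fin s) ℂ) : Matrix (Fin s) (Fin s) ℂ).map C *
        torusAct i₀ d e A * (Q : Matrix (Fin s) (Fin s) ℂ).map C := by
  unfold torusAct
  rw [Matrix.linSubstEntries_mul, Matrix.linSubstEntries_mul, Matrix.linSubstEntries_map_C,
    Matrix.linSubstEntries_map_C]
  simp only [Units.val_mul, Matrix.map_mul, Matrix.mul_assoc, inv_map_C_mul_cancel_left]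

/-- `det ((d,e) ⋆ A) = per_n` whenever `det A = per_n`: the normalisation undoes the character. -/
theorem det_torusAct (d e : Fin n → ℂˣ) {A : Matrix (Fin s) (Fin s) (MvPolynomial (Fin n × Fin n) ℂ)}
    (hA : A.det = perPoly (Fin n) ℂ) : (torusAct i₀ d e A).det = perPoly (Fin n) ℂ := by
  unfold torusAct
  rw [det_mul, det_map_C, det_linSubstEntries, hA, coe_torusGL, linSubst_diagonal_perPoly,
    det_normGL, ← mul_assoc, ← map_mul, ← coe_torusChar, Units.inv_mul, C_1, one_mul]

/-- `⋆` keeps the entries affine. -/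
theorem totalDegree_torusAct_le (d e : Fin n → ℂˣ)
    {A : Matrix (Fin s) (Fin s) (MvPolynomial (Fin n × Fin n) ℂ)}
    (hA : ∀ i j, (A i j).totalDegree ≤ 1) (i j : Fin s) :
    (torusAct i₀ d e A i j).totalDegree ≤ 1 := by
  unfold torusAct
  have h := totalDegree_map_C_mul_mul_map_C_le ((normGL i₀ d e : GL (Fin s) ℂ) : Matrix (Fin s) (Fin s) ℂ)
    (1 : Matrix (Fin s) (Fin s) ℂ) (totalDegree_linSubstEntries_le (torusGL d e) hA) i j
  rwa [Matrix.map_one C C_0 C_1, Matrix.mul_one] at h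

/-- `⋆` preserves affine determinantal representations of `per_n`. -/
theorem isAffineDetRepr_torusAct (d e : Fin n → ℂˣ)
    {A : Matrix (Fin s) (Fin s) (MvPolynomial (Fin n × Fin n) ℂ)}
    (hA : IsAffineDetRepr (perPoly (Fin n) ℂ) A) :
    IsAffineDetRepr (perPoly (Fin n) ℂ) (torusAct i₀ d e A) :=
  ⟨totalDegree_torusAct_le i₀ d e hA.1, det_torusAct i₀ d e hA.2⟩

/-- Coefficient matrices of `(d,e) ⋆ A`: `D · (d_k e_l · A_{kl})`. -/
theorem coeffMat_torusAct (d e : Fin n → ℂˣ)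
    {A : Matrix (Fin s) (Fin s) (MvPolynomial (Fin n × Fin n) ℂ)}
    (hA : ∀ i j, (A i j).totalDegree ≤ 1) (v : Fin n × Fin n) :
    coeffMat (torusAct i₀ d e A) v =
      ((normGL i₀ d e : GL (Fin s) ℂ) : Matrix (Fin s) (Fin s) ℂ) *
        (((d v.1 : ℂ) * e v.2) • coeffMat A v) := by
  unfold torusAct
  have h1 : coeffMat (Matrix.linSubstEntries (torusGL d e) A) v = ((d v.1 : ℂ) * e v.2) • coeffMat A v := by
    rw [coeffMat_linSubstEntries _ _ hA, coe_torusGL, sum_kron_diagonal_diagonal_smul]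
  rw [← h1]
  have h2 := coeffMat_C_mul_mul_C ((normGL i₀ d e : GL (Fin s) ℂ) : Matrix (Fin s) (Fin s) ℂ)
    (Matrix.linSubstEntries (torusGL d e) A) 1 v
  rwa [Matrix.map_one C C_0 C_1, Matrix.mul_one, Matrix.mul_one] at h2

/-- `⋆` does not raise the rank of any coefficient matrix. -/
theorem rank_coeffMat_torusAct_le (d e : Fin n → ℂˣ)
    {A : Matrix (Fin s) (Fin s) (MvPolynomial (Fin n × Fin n) ℂ)}
    (hA : ∀ i j, (A i j).totalDegree ≤ 1) (v : Fin n × Fin n) :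
    (coeffMat (torusAct i₀ d e A) v).rank ≤ (coeffMat A v).rank := by
  rw [coeffMat_torusAct i₀ d e hA v, Matrix.smul_eq_diagonal_mul]
  exact (rank_mul_le_right _ _).trans (rank_mul_le_right _ _)

/-- `⋆` does not raise the total coefficient rank `Σ_v rank A_v`. -/
theorem rankSum_torusAct_le (d e : Fin n → ℂˣ)
    {A : Matrix (Fin s) (Fin s) (MvPolynomial (Fin n × Fin n) ℂ)}
    (hA : ∀ i j, (A i j).totalDegree ≤ 1) :
    ∑ v : Fin n × Fin n, ((torusAct i₀ d e A).map (coeff (Finsupp.single v 1))).rank ≤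
      ∑ v : Fin n × Fin n, (A.map (coeff (Finsupp.single v 1))).rank :=
  Finset.sum_le_sum fun v _ => rank_coeffMat_torusAct_le i₀ d e hA v

/-! ### Gauge equivalence `B = P · A · Q` and the torus action -/

/-- Gauge equivalence is reflexive. -/
theorem gauge_refl (A : Matrix (Fin s) (Fin s) (MvPolynomial (Fin n × Fin n) ℂ)) :
    ∃ P Q : GL (Fin s) ℂ, A = (P : Matrix (Fin s) (Fin s) ℂ).map C * A * (Q : Matrix (Fin s) (Fin s) ℂ).map C :=
  ⟨1, 1, by simp [Matrix.map_one C C_0 C_1]⟩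

/-- Gauge equivalence is symmetric. -/
theorem gauge_symm {A B : Matrix (Fin s) (Fin s) (MvPolynomial (Fin n × Fin n) ℂ)}
    (h : ∃ P Q : GL (Fin s) ℂ, B = (P : Matrix (Fin s) (Fin s) ℂ).map C * A * (Q : Matrix (Fin s) (Fin s) ℂ).map C) :
    ∃ P Q : GL (Fin s) ℂ, A = (P : Matrix (Fin s) (Fin s) ℂ).map C * B * (Q : Matrix (Fin s) (Fin s) ℂ).map C := by
  obtain ⟨P, Q, rfl⟩ := h
  exact ⟨P⁻¹, Q⁻¹, (inv_map_C_mul_mul_map_C_inv P Q A).symm⟩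

/-- Gauge equivalence is transitive. -/
theorem gauge_trans {A B B' : Matrix (Fin s) (Fin s) (MvPolynomial (Fin n × Fin n) ℂ)}
    (h : ∃ P Q : GL (Fin s) ℂ, B = (P : Matrix (Fin s) (Fin s) ℂ).map C * A * (Q : Matrix (Fin s) (Fin s) ℂ).map C)
    (h' : ∃ P Q : GL (Fin s) ℂ, B' = (P : Matrix (Fin s) (Fin s) ℂ).map C * B * (Q : Matrix (Fin s) (Fin s) ℂ).map C) :
    ∃ P Q : GL (Fin s) ℂ, B' = (P : Matrix (Fin s) (Fin s) ℂ).map C * A * (Q : Matrix (Fin s) (Fin s) ℂ).map C := by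
  obtain ⟨P, Q, rfl⟩ := h
  obtain ⟨P', Q', rfl⟩ := h'
  exact ⟨P' * P, Q * Q', by simp only [Units.val_mul, Matrix.map_mul, Matrix.mul_assoc]⟩

/-- The torus action descends to gauge classes. -/
theorem gauge_torusAct (d e : Fin n → ℂˣ) {A B : Matrix (Fin s) (Fin s) (MvPolynomial (Fin n × Fin n) ℂ)}
    (h : ∃ P Q : GL (Fin s) ℂ, B = (P : Matrix (Fin s) (Fin s) ℂ).map C * A * (Q : Matrix (Fin s) (Fin s) ℂ).map C) :
    ∃ P Q : GL (Fin s) ℂ, torusAct i₀ d e B =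
      (P : Matrix (Fin s) (Fin s) ℂ).map C * torusAct i₀ d e A * (Q : Matrix (Fin s) (Fin s) ℂ).map C := by
  obtain ⟨P, Q, rfl⟩ := h
  exact ⟨_, Q, torusAct_gauge i₀ d e P Q A⟩

/-! ### Roots in the torus, and nondegeneracy -/

/-- Roots in the torus: `ℂ` is algebraically closed, so every `d ∈ (ℂˣ)ⁿ` is a `K`-th power. -/
theorem exists_pow_eq (d : Fin n → ℂˣ) {K : ℕ} (hK : 0 < K) : ∃ d' : Fin n → ℂˣ, d' ^ K = d := by
  have h : ∀ i, ∃ u : ℂˣ, u ^ K = d i := fun i => by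
    obtain ⟨z, hz⟩ := IsAlgClosed.exists_pow_nat_eq (d i : ℂ) hK
    have hz0 : z ≠ 0 := by
      rintro rfl
      rw [zero_pow hK.ne'] at hz
      exact (d i).ne_zero hz.symm
    exact ⟨Units.mk0 z hz0, Units.ext (by simp [hz])⟩
  choose f hf using h
  exact ⟨f, funext hf⟩

/-- An affine determinantal representation of `per_n`, `n ≥ 1`, is not the empty matrix. -/
theorem pos_of_isAffineDetRepr (hn : 1 ≤ n) {A : Matrix (Fin s) (Fin s) (MvPolynomial (Fin n × Fin n) ℂ)}
    (hA : IsAffineDetRepr (perPoly (Fin n) ℂ) A) : 0 < s := by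
  rcases Nat.eq_zero_or_pos s with rfl | h
  · exfalso
    have h1 : A.det = 1 := Matrix.det_isEmpty
    have h2 := congrArg constantCoeff hA.2
    rw [h1, constantCoeff_perPoly ℂ hn, map_one] at h2
    exact one_ne_zero h2
  · exact h

end Summit.ValiantsHypothesis.ValiantsHypothesis.Theorems.RigidMinimalRepsOrbitsForceTorus

end
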